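import Summits.Ventures.LatticeQCDFlow.Scaling.ApproximateEigenfunctionFloor
import Summits.Ventures.LatticeQCDFlow.Scaling.ReplicaExchangeBareSampler

/-!
HONEST FRAMING: exact (Metropolis-corrected) sampling algorithms for lattice gauge theory; figures
of merit are autocorrelation/cost numbers at stated couplings and volumes; no continuum-physics
claim.

# LadderStaleWeights — THE STALE-SET CHAIN OF THE HOMOGENEOUS LADDER (`D ↦ σ_j(D)` w.p. `t/K` EACH, `D ↦ D∖{0}` w.p. `h`, ELSE IDLE) AND THE ROBIN MODE AS AN EXACT
# LYAPUNOV WEIGHT: `E[Σ_{k∈D'} c_k] = (1−ρ)·Σ_{k∈D} c_k`, `E[Σ_{k∈D_n} c_k] = (1−ρ)ⁿ·Σ_{k∈D_0} c_k`, AND **`P(D_n ≠ ∅) ≤ (1−ρ)ⁿ·(Σ_{k≤K} c_k)/c_min`** (lean-2 GEN-47, ours)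

Venture-side (OURS).  Cell `lqcd-flow` (pub-lqcd), unit `pub-lqcd-lean-2-g47`, 2026-08-31.  Chapter AG, file 6 — the ceiling side, set-chain level (the ladder analogue of chapter L
file 12, `Scaling/DirtySetDecay`).  The STALE SET `D ⊆ Fin (K+1)` of the homogeneous ladder (positions whose content has not passed through the hot redraw since time `0`) is
an autonomous chain `Q`: an accepted swap of the pair `(j, j+1)` transports staleness (`D ↦ σ_j(D)`, probability `t/K` each), a hot redraw cleans position `0` (`D ↦ D∖{0}`,
probability `h`), otherwise nothing moves.  For ANY weight vector `c` the expected one-step change of `F(D) = Σ_{k∈D} c_k` is `Σ_{k∈D}((t/K)(Δ_Neumann c)_k − h·1{k=0}c_0)` — the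
same matrix as on one-level sums (file 2) — so under the three mode equations of file 1 `F` is an EXACT eigenfunction of `Q`, `QF = (1−ρ)F`, and with every `c_k ≥ c_min > 0`
(file 5) Markov's inequality bounds the survival of stale material: `P(D_n ≠ ∅) ≤ (1−ρ)ⁿ F(D_0)/c_min`.  Hypothesis-equation `hQ`; no definitions.

* §1 `sum_indicator_mul`, **`stale_sum_mul`** (the one-step action on any test function), `stale_isRowStochastic`; `staleWeight_image` (`F(σ_j D) = Σ_{k∈D} c_{σ_j k}`),
  `staleWeight_erase` (`F(D∖{0}) = F(D) − 1{0∈D}c_0`).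
* §2 `levelSwap_coeff_diff` (per pair: `c_{σ_j k} − c_k`), `sum_levelSwap_coeff_diff` (the vertex form `Σ_j(c_{σ_j k} − c_k) = 1{k<K}(c_{k+1} − c_k) + 1{k≥1}(c_{k−1} − c_k)`),
  `ladderMode_vertex` (the three mode equations, vertex by vertex), **`stale_weight_eigen`** (`Σ_{D'}Q(D,D')F(D') = (1−ρ)F(D)`).
* §3 **`stale_weight_lawAt`** (`E[F(D_n)] = (1−ρ)ⁿF(D_0)`), **`stale_nonempty_le`** (`P_{D_0}(D_n ≠ ∅) ≤ (1−ρ)ⁿ·F(D_0)/c_min`).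

Reading (no numerics implied): staleness diffuses along the ladder like a one-level statistic and is absorbed at the hot end; its total weight in the slowest mode decays at
exactly the mode's rate.  Files 7–8 show that the configuration law is within `P(D_n ≠ ∅)` of equilibrium (freshness), file 9 assembles the ceiling.  Literature grade (cell rule):
ELEMENTARY, NEW TYPING; nothing cited; no new bib keys.
-/

noncomputable section

open Finset Function
open Literature.Probability.MarkovChains

namespace Summit.Ventures.LatticeQCDFlow.Scaling

section Stale
variable {K : ℕ} {t h : ℝ} {Q : Finset (Fin (K + 1)) → Finset (Fin (K + 1)) → ℝ} {c : ℕ → ℝ}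

/-! ## §1 The stale-set chain and its action -/

/-- `Σ_{D'} 1{D' = A}·G(D') = G(A)`. [ours] -/
theorem sum_indicator_mul {α : Type*} [Fintype α] [DecidableEq α] (A : α) (G : α → ℝ) : ∑ D', (if D' = A then (1 : ℝ) else 0) * G D' = G A := by
  simp_rw [ite_mul, one_mul, zero_mul]
  rw [Finset.sum_ite_eq' univ A, if_pos (mem_univ _)]

/-- **THE ONE-STEP ACTION ON ANY TEST FUNCTION:** `Σ_{D'}Q(D,D')G(D') = (t/K)Σ_jG(σ_jD) + h·G(D∖{0}) + (1−t−h)·G(D)`. [ours] -/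
theorem stale_sum_mul
    (hQ : ∀ D D', Q D D' = (∑ j : Fin K, t / K * (if D' = D.image (levelSwap j) then (1 : ℝ) else 0))
      + h * (if D' = D.erase 0 then (1 : ℝ) else 0) + (1 - t - h) * (if D' = D then (1 : ℝ) else 0))
    (D : Finset (Fin (K + 1))) (G : Finset (Fin (K + 1)) → ℝ) :
    ∑ D', Q D D' * G D' = t / K * ∑ j : Fin K, G (D.image (levelSwap j)) + h * G (D.erase 0) + (1 - t - h) * G D := by
  have e : ∀ D', Q D D' * G D' = (∑ j : Fin K, t / K * ((if D' = D.image (levelSwap j) then (1 : ℝ) else 0) * G D'))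
      + h * ((if D' = D.erase 0 then (1 : ℝ) else 0) * G D') + (1 - t - h) * ((if D' = D then (1 : ℝ) else 0) * G D') := by
    intro D'; rw [hQ, add_mul, add_mul, sum_mul]; congr 1; congr 1
    · exact sum_congr rfl fun j _ => by ring
    · ring
    · ring
  simp_rw [e]
  rw [sum_add_distrib, sum_add_distrib, ← mul_sum, ← mul_sum, sum_indicator_mul, sum_indicator_mul, sum_comm]
  simp_rw [← mul_sum, sum_indicator_mul]

/-- **The stale-set chain is a transition matrix** (`K ≥ 1`, `t, h ≥ 0`, `t + h ≤ 1`). [ours] -/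
theorem stale_isRowStochastic (hK : 1 ≤ K) (ht0 : 0 ≤ t) (hh0 : 0 ≤ h) (hth : t + h ≤ 1)
    (hQ : ∀ D D', Q D D' = (∑ j : Fin K, t / K * (if D' = D.image (levelSwap j) then (1 : ℝ) else 0))
      + h * (if D' = D.erase 0 then (1 : ℝ) else 0) + (1 - t - h) * (if D' = D then (1 : ℝ) else 0)) : IsRowStochastic Q := by
  have hKpos : (0 : ℝ) < K := Nat.cast_pos.mpr (by omega)
  refine ⟨fun D D' => ?_, fun D => ?_⟩
  · rw [hQ]
    exact add_nonneg (add_nonneg (sum_nonneg fun j _ => mul_nonneg (by positivity) (by split_ifs <;> norm_num))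
      (mul_nonneg hh0 (by split_ifs <;> norm_num))) (mul_nonneg (by linarith) (by split_ifs <;> norm_num))
  · have h1 := stale_sum_mul hQ D (fun _ => (1 : ℝ))
    simp only [mul_one, sum_const, card_univ, Fintype.card_fin, nsmul_eq_mul] at h1
    rw [h1]; field_simp; ring

/-- `F(σ_j D) = Σ_{k∈D} c_{σ_j k}` (a transposition is injective). [ours] -/
theorem staleWeight_image (c : ℕ → ℝ) (j : Fin K) (D : Finset (Fin (K + 1))) :
    ∑ k ∈ D.image (levelSwap j), c k = ∑ k ∈ D, c (levelSwap j k : Fin (K + 1)) := by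
  rw [Finset.sum_image fun x _ y _ hxy => (levelSwap j).injective hxy]

/-- `F(D∖{0}) = F(D) − 1{0 ∈ D}·c_0`. [ours] -/
theorem staleWeight_erase (c : ℕ → ℝ) (D : Finset (Fin (K + 1))) :
    ∑ k ∈ D.erase 0, c k = ∑ k ∈ D, c k - (if (0 : Fin (K + 1)) ∈ D then c 0 else 0) := by
  by_cases h0 : (0 : Fin (K + 1)) ∈ D
  · rw [if_pos h0, ← Finset.add_sum_erase D (fun k : Fin (K + 1) => c k) h0]; simp
  · rw [if_neg h0, Finset.erase_eq_of_notMem h0, sub_zero]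

/-! ## §2 The mode is an exact eigenfunction of the stale-set chain -/

/-- Per pair: `c_{σ_j k} − c_k = 1{k = j}(c_{k+1} − c_k) + 1{k = j+1}(c_{k−1} − c_k)`. [ours] -/
theorem levelSwap_coeff_diff (c : ℕ → ℝ) (j : Fin K) (k : Fin (K + 1)) :
    c (levelSwap j k : Fin (K + 1)) - c k
      = (if (k : ℕ) = j then c ((k : ℕ) + 1) - c k else 0) + (if (k : ℕ) = (j : ℕ) + 1 then c ((k : ℕ) - 1) - c k else 0) := by
  have h1 : ((j.castSucc : Fin (K + 1)) : ℕ) = j := Fin.val_castSucc j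
  have h2 : ((j.succ : Fin (K + 1)) : ℕ) = j + 1 := Fin.val_succ j
  unfold levelSwap
  by_cases hk1 : k = j.castSucc
  · subst hk1
    rw [Equiv.swap_apply_left, h2, h1, if_pos rfl, if_neg (by omega)]
    ring
  · by_cases hk2 : k = j.succ
    · subst hk2
      rw [Equiv.swap_apply_right, h1, h2, if_neg (by omega), if_pos rfl, Nat.add_sub_cancel]
      ring
    · rw [Equiv.swap_apply_of_ne_of_ne hk1 hk2, sub_self, if_neg, if_neg, add_zero]
      · intro h; exact hk2 (Fin.ext (by rw [h, h2]))
      · intro h; exact hk1 (Fin.ext (by rw [h, h1]))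

/-- **The vertex form:** `Σ_j(c_{σ_j k} − c_k) = 1{k < K}(c_{k+1} − c_k) + 1{k ≥ 1}(c_{k−1} − c_k)` (`k ≤ K`). [ours] -/
theorem sum_levelSwap_coeff_diff (c : ℕ → ℝ) (k : Fin (K + 1)) :
    ∑ j : Fin K, (c (levelSwap j k : Fin (K + 1)) - c k)
      = (if (k : ℕ) = K then 0 else c ((k : ℕ) + 1) - c k) + (if (k : ℕ) = 0 then 0 else c ((k : ℕ) - 1) - c k) := by
  have hk : (k : ℕ) ≤ K := Nat.lt_succ_iff.mp k.2
  simp_rw [levelSwap_coeff_diff c]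
  rw [sum_add_distrib]
  congr 1
  · rw [Fin.sum_univ_eq_sum_range (fun j : ℕ => if (k : ℕ) = j then c ((k : ℕ) + 1) - c k else 0) K, Finset.sum_ite_eq (Finset.range K)]
    by_cases hkK : (k : ℕ) = K
    · rw [if_neg (by rw [Finset.mem_range]; omega), if_pos hkK]
    · rw [if_pos (by rw [Finset.mem_range]; omega), if_neg hkK]
  · rw [Fin.sum_univ_eq_sum_range (fun j : ℕ => if (k : ℕ) = j + 1 then c ((k : ℕ) - 1) - c k else 0) K]
    by_cases hk0 : (k : ℕ) = 0
    · rw [if_pos hk0]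
      exact sum_eq_zero fun j _ => if_neg (by omega)
    · rw [if_neg hk0]
      have e : ∀ j : ℕ, (if (k : ℕ) = j + 1 then c ((k : ℕ) - 1) - c k else 0) = (if (k : ℕ) - 1 = j then c ((k : ℕ) - 1) - c k else 0) :=
        fun j => if_congr (by omega) rfl rfl
      simp_rw [e]
      rw [Finset.sum_ite_eq (Finset.range K), if_pos (by rw [Finset.mem_range]; omega)]

/-- **The three mode equations, vertex by vertex:** `(t/K)(c_1 − c_0) − h·c_0 = −ρc_0`, `(t/K)(c_n − 2c_{n+1} + c_{n+2}) = −ρc_{n+1}` (`n+2 ≤ K`), `(t/K)(c_{K−1} − c_K) = −ρc_K`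
(`K ≥ 1`) ⇒ for every `k ≤ K`: `(t/K)·[1{k<K}(c_{k+1} − c_k) + 1{k≥1}(c_{k−1} − c_k)] − h·1{k=0}c_0 = −ρ·c_k`. [ours] -/
theorem ladderMode_vertex (hK : 1 ≤ K) {ρ : ℝ} (h0 : t / K * (c 1 - c 0) - h * c 0 = -ρ * c 0)
    (hint : ∀ n : ℕ, n + 2 ≤ K → t / K * (c n - 2 * c (n + 1) + c (n + 2)) = -ρ * c (n + 1))
    (hfar : t / K * (c (K - 1) - c K) = -ρ * c K) (k : Fin (K + 1)) :
    t / K * ((if (k : ℕ) = K then 0 else c ((k : ℕ) + 1) - c k) + (if (k : ℕ) = 0 then 0 else c ((k : ℕ) - 1) - c k))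
      - (if (k : ℕ) = 0 then h * c 0 else 0) = -ρ * c k := by
  have hkK : (k : ℕ) ≤ K := Nat.lt_succ_iff.mp k.2
  by_cases hk0 : (k : ℕ) = 0
  · rw [if_pos hk0, if_pos hk0, if_neg (by omega), hk0]
    simp only [zero_add, add_zero]
    linarith [h0]
  · rw [if_neg hk0, if_neg hk0]
    by_cases hkK' : (k : ℕ) = K
    · rw [if_pos hkK', hkK']
      linarith [hfar]
    · rw [if_neg hkK']
      obtain ⟨m, hm⟩ := Nat.exists_eq_succ_of_ne_zero hk0
      have h := hint m (by omega)
      rw [hm, Nat.succ_sub_one]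
      have e1 : c m.succ = c (m + 1) := rfl
      have e2 : c (m.succ + 1) = c (m + 2) := rfl
      rw [e1, e2]
      linarith [h]

/-- **THE MODE IS AN EXACT EIGENFUNCTION OF THE STALE-SET CHAIN: `Σ_{D'}Q(D,D')·F(D') = (1−ρ)·F(D)`**, `F(D) = Σ_{k∈D}c_k`. [ours] -/
theorem stale_weight_eigen (hK : 1 ≤ K)
    (hQ : ∀ D D', Q D D' = (∑ j : Fin K, t / K * (if D' = D.image (levelSwap j) then (1 : ℝ) else 0))
      + h * (if D' = D.erase 0 then (1 : ℝ) else 0) + (1 - t - h) * (if D' = D then (1 : ℝ) else 0))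
    {ρ : ℝ} (h0 : t / K * (c 1 - c 0) - h * c 0 = -ρ * c 0)
    (hint : ∀ n : ℕ, n + 2 ≤ K → t / K * (c n - 2 * c (n + 1) + c (n + 2)) = -ρ * c (n + 1))
    (hfar : t / K * (c (K - 1) - c K) = -ρ * c K) (D : Finset (Fin (K + 1))) :
    ∑ D', Q D D' * ∑ k ∈ D', c k = (1 - ρ) * ∑ k ∈ D, c k := by
  have hKpos : (0 : ℝ) < K := Nat.cast_pos.mpr (by omega)
  rw [stale_sum_mul hQ D (fun D' => ∑ k ∈ D', c k)]
  simp_rw [staleWeight_image c]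
  rw [staleWeight_erase c D]
  -- `Σ_j Σ_{k∈D} c(σ_j k) = K·F(D) + Σ_{k∈D} V_k`
  have hswap : ∑ j : Fin K, ∑ k ∈ D, c (levelSwap j k : Fin (K + 1))
      = K * ∑ k ∈ D, c k + ∑ k ∈ D, ((if (k : ℕ) = K then 0 else c ((k : ℕ) + 1) - c k) + (if (k : ℕ) = 0 then 0 else c ((k : ℕ) - 1) - c k)) := by
    have e : ∀ j : Fin K, ∑ k ∈ D, c (levelSwap j k : Fin (K + 1)) = ∑ k ∈ D, c k + ∑ k ∈ D, (c (levelSwap j k : Fin (K + 1)) - c k) := by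
      intro j; rw [← sum_add_distrib]; exact sum_congr rfl fun k _ => by ring
    simp_rw [e]
    rw [sum_add_distrib, sum_const, card_univ, Fintype.card_fin, nsmul_eq_mul, sum_comm]
    congr 1
    exact sum_congr rfl fun k _ => sum_levelSwap_coeff_diff c k
  rw [hswap]
  -- the hot term as a sum over `D`
  have hhot : (if (0 : Fin (K + 1)) ∈ D then c 0 else 0) = ∑ k ∈ D, (if (k : ℕ) = 0 then c 0 else 0) := by
    by_cases h0D : (0 : Fin (K + 1)) ∈ D
    · rw [if_pos h0D, ← Finset.add_sum_erase D _ h0D]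
      simp only [Fin.val_zero, if_true]
      rw [sum_eq_zero fun k hk => ?_, add_zero]
      rw [if_neg]
      have := Finset.ne_of_mem_erase hk
      exact fun h => this (Fin.ext h)
    · rw [if_neg h0D]
      refine (sum_eq_zero fun k hk => if_neg fun h => h0D ?_).symm
      have : k = 0 := Fin.ext h
      rwa [this] at hk
  rw [hhot]
  -- vertex by vertex
  have hv : ∀ k ∈ D, t / K * ((if (k : ℕ) = K then 0 else c ((k : ℕ) + 1) - c k) + (if (k : ℕ) = 0 then 0 else c ((k : ℕ) - 1) - c k))
      - h * (if (k : ℕ) = 0 then c 0 else 0) = -ρ * c k := by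
    intro k _
    have := ladderMode_vertex hK h0 hint hfar k
    have e : h * (if (k : ℕ) = 0 then c 0 else 0) = (if (k : ℕ) = 0 then h * c 0 else 0) := by split_ifs <;> ring
    rw [e]; exact this
  have htot : t / K * ∑ k ∈ D, ((if (k : ℕ) = K then 0 else c ((k : ℕ) + 1) - c k) + (if (k : ℕ) = 0 then 0 else c ((k : ℕ) - 1) - c k))
      - h * ∑ k ∈ D, (if (k : ℕ) = 0 then c 0 else 0) = -ρ * ∑ k ∈ D, c k := by
    rw [mul_sum, mul_sum, mul_sum, ← sum_sub_distrib]
    exact sum_congr rfl hv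
  have e : t / K * ((K : ℝ) * ∑ k ∈ D, c k) = t * ∑ k ∈ D, c k := by field_simp
  linear_combination htot + e

/-! ## §3 Decay of the stale weight and survival of staleness -/

/-- **`E_{D_0}[F(D_n)] = (1−ρ)ⁿ·F(D_0)`** for every `n` (`0 < ρ ≤ 1`). [ours] -/
theorem stale_weight_lawAt (hK : 1 ≤ K) (ht0 : 0 ≤ t) (hh0 : 0 ≤ h) (hth : t + h ≤ 1)
    (hQ : ∀ D D', Q D D' = (∑ j : Fin K, t / K * (if D' = D.image (levelSwap j) then (1 : ℝ) else 0))
      + h * (if D' = D.erase 0 then (1 : ℝ) else 0) + (1 - t - h) * (if D' = D then (1 : ℝ) else 0))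
    {ρ : ℝ} (hρ0 : 0 < ρ) (hρ1 : ρ ≤ 1) (h0 : t / K * (c 1 - c 0) - h * c 0 = -ρ * c 0)
    (hint : ∀ n : ℕ, n + 2 ≤ K → t / K * (c n - 2 * c (n + 1) + c (n + 2)) = -ρ * c (n + 1))
    (hfar : t / K * (c (K - 1) - c K) = -ρ * c K) (D₀ : Finset (Fin (K + 1))) (n : ℕ) :
    lawMean (lawAt Q (Pi.single D₀ 1) n) (fun D => ∑ k ∈ D, c k) = (1 - ρ) ^ n * ∑ k ∈ D₀, c k := by
  have hQst := stale_isRowStochastic hK ht0 hh0 hth hQ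
  have heig : ∀ D, |∑ D', Q D D' * (∑ k ∈ D', c k) - (1 - ρ) * ∑ k ∈ D, c k| ≤ 0 := fun D => by
    rw [stale_weight_eigen hK hQ h0 hint hfar D, sub_self, abs_zero]
  have h := approxEigen_lawMean_lawAt (P := Q) (Φ := fun D : Finset (Fin (K + 1)) => ∑ k ∈ D, c k) (lam := 1 - ρ) (δ := 0) hQst heig
    (by linarith) (by linarith) D₀ n
  rw [zero_div] at h
  have := abs_nonpos_iff.mp h
  linarith [this, sub_eq_zero.mp this]

/-- **SURVIVAL OF STALENESS: `P_{D_0}(D_n ≠ ∅) ≤ (1−ρ)ⁿ·F(D_0)/c_min`** when every `c_k ≥ c_min > 0` (`k ≤ K`). [ours] -/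
theorem stale_nonempty_le (hK : 1 ≤ K) (ht0 : 0 ≤ t) (hh0 : 0 ≤ h) (hth : t + h ≤ 1)
    (hQ : ∀ D D', Q D D' = (∑ j : Fin K, t / K * (if D' = D.image (levelSwap j) then (1 : ℝ) else 0))
      + h * (if D' = D.erase 0 then (1 : ℝ) else 0) + (1 - t - h) * (if D' = D then (1 : ℝ) else 0))
    {ρ : ℝ} (hρ0 : 0 < ρ) (hρ1 : ρ ≤ 1) (h0 : t / K * (c 1 - c 0) - h * c 0 = -ρ * c 0)
    (hint : ∀ n : ℕ, n + 2 ≤ K → t / K * (c n - 2 * c (n + 1) + c (n + 2)) = -ρ * c (n + 1))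
    (hfar : t / K * (c (K - 1) - c K) = -ρ * c K) {cmin : ℝ} (hcmin : 0 < cmin) (hcge : ∀ k : ℕ, k ≤ K → cmin ≤ c k)
    (D₀ : Finset (Fin (K + 1))) (n : ℕ) :
    ∑ D ∈ univ.filter (fun D : Finset (Fin (K + 1)) => D ≠ ∅), lawAt Q (Pi.single D₀ 1) n D ≤ (1 - ρ) ^ n * (∑ k ∈ D₀, c k) / cmin := by
  have hQst := stale_isRowStochastic hK ht0 hh0 hth hQ
  have hμ0 : ∀ D, 0 ≤ (Pi.single D₀ (1 : ℝ) : Finset (Fin (K + 1)) → ℝ) D := fun D => by rw [Pi.single_apply]; split_ifs <;> norm_num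
  have hl0 : ∀ D, 0 ≤ lawAt Q (Pi.single D₀ 1) n D := fun D => lawAt_nonneg hQst hμ0 n D
  have hmean := stale_weight_lawAt hK ht0 hh0 hth hQ hρ0 hρ1 h0 hint hfar D₀ n
  -- `cmin·1{D ≠ ∅} ≤ F(D)`
  have hF : ∀ D : Finset (Fin (K + 1)), D ≠ ∅ → cmin ≤ ∑ k ∈ D, c k := by
    intro D hD
    obtain ⟨k, hk⟩ := Finset.nonempty_iff_ne_empty.mpr hD
    have hck : ∀ k ∈ D, 0 ≤ c k := fun k _ => le_trans hcmin.le (hcge k (Nat.lt_succ_iff.mp k.2))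
    calc cmin ≤ c k := hcge k (Nat.lt_succ_iff.mp k.2)
      _ ≤ ∑ k ∈ D, c k := Finset.single_le_sum hck hk
  rw [le_div_iff₀ hcmin, ← hmean]
  unfold lawMean
  rw [sum_mul]
  calc ∑ D ∈ univ.filter (fun D : Finset (Fin (K + 1)) => D ≠ ∅), lawAt Q (Pi.single D₀ 1) n D * cmin
      ≤ ∑ D ∈ univ.filter (fun D : Finset (Fin (K + 1)) => D ≠ ∅), lawAt Q (Pi.single D₀ 1) n D * ∑ k ∈ D, c k :=
        sum_le_sum fun D hD => mul_le_mul_of_nonneg_left (hF D (Finset.mem_filter.mp hD).2) (hl0 D)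
    _ ≤ ∑ D, lawAt Q (Pi.single D₀ 1) n D * ∑ k ∈ D, c k := by
        refine Finset.sum_le_univ_sum_of_nonneg fun D => ?_
        by_cases hD : D = ∅
        · rw [hD]; simp
        · exact mul_nonneg (hl0 D) (le_trans hcmin.le (hF D hD))

end Stale

end Summit.Ventures.LatticeQCDFlow.Scaling

end
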